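import Literature.AlgebraicGeometry.ShimuraVarieties.RapoportSmithlingZhang2020.Sec3IntegralModels        -- ★ `ShimuraDatum`, `Sec3Data` (`clauses`, `𝔞`, `ξ`, `label`, `M0`), `M0Obj`, `M0Obj.Iso`, `signatureFn`, `reflexFieldOf`, `phi0ToReflexFieldOf`
import Literature.AlgebraicGeometry.ShimuraVarieties.RapoportSmithlingZhang2020.Sec2GroupTheoreticSetup   -- ★ `Sec2Datum` (`Wflat`, `incl`, `Idx`, `gramW`), `cbar`
import Literature.NumberTheory.Automorphic.Liu2021.AppendixC.SecC4IntegralModelsUniformization        -- ★ `IsInert`, `IsSplit`, `residueChar` (primes of `F₀` in `F`)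
import Literature.AlgebraicGeometry.ShimuraVarieties.KudlaRapoport2013.Sec4RelationToShimuraVarieties   -- ★ `GU σ J` (TKR-t02; squad ruling R-6: the one similitude-carrier bridge)
import HarnessLib

/-!
# [RapoportSmithlingZhang2020Diagonal] §5 «Global integral models» (§5.1 «Trivial level structure», §5.2 «Drinfeld level structure»)
# — STATED AS PRINTED (named-fact carpet; NO proofs, NO `sorry`, NO instance, NO notation)

M. Rapoport, B. Smithling, W. Zhang, *Arithmetic diagonal cycles on unitary Shimura varieties*, Compos. Math. **156** (2020)
1745–1824 = arXiv:1710.06962 **v6** (bib key `RapoportSmithlingZhang2020Diagonal`).  PAGE PINS «p. N» = arXiv v6 PDF page, read on the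
cell's per-page text of record `F0/P6/lit1/RSZ2020-v6-pages.txt` (item map `RSZ2020-v6-itemmap.lit1-g5.md` 15cc0883: «§5 Global integral models
p. 27: 5.1 trivial level p. 27; 5.2 Drinfeld level p. 30», «Remark 5.1 p. 28 · Thm. 5.2 p. 28 · Remark 5.3 p. 29 · Thm. 5.4 p. 30», «(5.1)–(5.2) p. 27 ·
(5.3) p. 28 · (5.4)–(5.5) p. 29 · (5.6)–(5.10) p. 30 · (5.11) p. 31»); the Compositio offset is not held and no journal page is claimed.  Where the page
text drops a glyph (the relation signs of (5.2), the decoration of `K_G^∘`), the reading is taken from the TeX source of the arXiv v1 text held as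
`paper:arxiv-1710.06962` (chunk p0022: `\Lambda\subset \Lambda^\vee \subset (\mathfrak d_{AT}^W)^{-1} \Lambda`, `K_G^\circ`), whose §5.1 wording is
otherwise identical except in condition (2) below, where v6 («unramified over `ℚ`») supersedes v1 («of degree one over `ℚ`») and v6 IS what is typed.

Cell `hodgecm-mathlib`, GO-500 carpet squad TKR (seat TKR-t04), file 2 of the t04 deal (TKR-plan SPLIT-TKR.v1 7831d55e3c6c3b32 §D: «RSZ2020 §5 →
`Sec5GlobalIntegralModels.lean` (v6 pp. 27–30: (5.1)–(5.11), Rem. 5.1, Thm. 5.2, Rem. 5.3, Thm. 5.4; import TL-t10's `Sec3IntegralModels`)»).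
HONEST LABEL: HC_CM is proved only modulo the 7 printed citations (2 remaining: hLiu418 = stmt-HodgeConjecture-24832, h413 = stmt-HodgeConjecture-24833)
until rung 0 closes; this file asserts NOTHING — every printed claim is a `def … : Prop` that a consumer takes as a hypothesis `(h : Item D)` for ITS
OWN datum `D : Sec5Data F₀ F`, and nothing printed is claimed to hold.

## How the printed objects are typed (paper order).  REAL = genuine Mathlib ∕ tree object; ⟨CARRIER⟩ = posited datum standing for a printed object
## Lean cannot construct (the discipline of ★ `Sec3IntegralModels.Sec3Data`); READINGS R1–R7.

* THE DATUM (READING R1).  §5 works in the setting of §3 with «`𝔞 = O_{F₀}`, i.e., we will assume that `M₀ = M₀^{O_{F₀}}` is non-empty … We fix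
  `ξ ∈ L_Φ^{O_{F₀}}/∼` and set `M₀^ξ := M₀^{O_{F₀},ξ}`» (p. 27) = ★ `Sec3Data` with the extra hypothesis field `𝔞_eq_top : 𝔞 = ⊤`; and it uses `W♭`,
  `H = U(W♭)` of §2 = ★ `Sec2Datum` (same `W`, `two_le_n`, `u`, `form_u_ne_zero` fields, merged by `extends`).  `structure Sec5Data extends Sec3Data,
  Sec2Datum` adds the §5 data: the lattices `Λ ⊂ W`, `Λ♭ ⊂ W♭` (REAL, READING R2), the printed standing hypotheses (5.2), (1), (2) as `Prop` FIELDS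
  (hypotheses of the datum, not named facts), and the ⟨CARRIER⟩ objects listed below.  Nothing is asserted by the structure.
* §1 NOTATION prerequisites (pp. 6–7), typed HERE because §5 is their first consumer in the carpet (REAL): «`inv_v(W_v) := (−1)^{n(n−1)/2} det W_v ∈
  F₀,v^×/Nm F_v^×` (1.4)», «`W_v` is split at a finite place `v` if `inv_v(W_v) = 1`», «`−W` … the hermitian form multiplied by `−1`» (p. 6) — via the REAL
  predicate `IsNormAt v a` («`a` is a norm from `F_v = F ⊗_{F₀} F₀,v`», Mathlib `adicCompletion`) applied to `(−1)^{n(n−1)/2} det J` for a Gram matrix `J`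
  (`hermIsSplitAt`; READING R3: `F₀,v^×/Nm F_v^×` has order ≤ 2, so an equality of invariants in it is typed as «trivial iff trivial»);
  «`v` ramifies in `F`» = neither split nor inert (★ `Liu2021…SecC4.IsSplit`/`IsInert`); «unramified ∕ of degree one over `ℚ`» via Mathlib
  `Ideal.ramificationIdx`/`Ideal.inertiaDeg` over `ℤ`; «unit at `v`», «`ord_v = 1`» via Mathlib `HeightOneSpectrum.valuation` at the primes of `F` over `v`.
  The LOCAL LATTICE TYPES of p. 7 («vertex lattice of type `r`: `Λ ⊂^r Λ^∨ ⊂ π_v^{-1}Λ`», «self-dual» = type 0, «almost self-dual» = type 1, «`π_v`-modular: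
  `Λ^∨ = π_v^{-1}Λ`», «almost `π_v`-modular: `Λ ⊂ Λ^∨ ⊂^1 π_v^{-1}Λ`») are ⟨CARRIER⟩ predicates `IsVertexTypeAt`/`IsPiModularAt`/`IsAlmostPiModularAt` on a
  global lattice at a place (completed lattices `Λ ⊗_{O_F} O_{F,v}` inside `W ⊗_{F₀} F₀,v` are not constructed here), each quoting its print.
* LATTICES (READING R2).  «an `O_F`-lattice `Λ` in `W`» = a finitely generated `O_F`-submodule of the COORDINATE space of `W` spanning it over `F`: for `W`
  the ADAPTED coordinates `Fin (n−1) ⊕ Unit` of ★ `Sec2Datum` (`W = W♭ ⊕ F u`, Gram matrix ★ `gramW`), for `W♭` the coordinates of ★ `Wflat.basis` (Gram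
  matrix ★ `Wflat.gram`) — so that «`Λ = Λ♭ ⊕ O_F u`» (p. 29) is literal.  The hermitian form on coordinates is `hermForm J x y = Σ x_i ȳ_j J_{ji}` (★ `gram`
  convention `J i j = (e_j, e_i)`), and «`Λ^∨`, the dual lattice with respect to the hermitian form» (pp. 6–7) enters through the REAL predicate
  `InDual J L x` = «`(x, y) ∈ O_F` for all `y ∈ Λ`».
* (5.1) `V_AT^W`, `𝔡_AT^W` and (5.2) are REAL: `VAT J := {v ∣ v inert in F and W_v non-split, or v ramifies in F}`, «`q_v` the (unique) prime in `O_F`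
  determined by `v ∈ V_AT^W`» = the radical of `p_v O_F` (READING R4: equal to `q_v` for `v` non-split), `dAT J := ∏_{v ∈ V_AT} q_v` (Mathlib `finprod`; the
  printed set is finite), and (5.2) «`Λ ⊂ Λ^∨ ⊂ (𝔡_AT^W)^{-1}Λ`» = the two fields `Λ_integral`, `Λ_dual_le`.  Conditions (1), (2) (p. 27) are the fields
  `cond1`, `cond2` (REAL except the AT-type clauses, which rest on the lattice-type carriers: `IsATType`, §4.4 p. 22 quoted verbatim).
* `K_G^∘ := {g ∈ G(𝔸_{F₀,f}) ∣ g(Λ ⊗_{O_F} Ô_F) = Λ ⊗_{O_F} Ô_F}`, `K_{G̃}^∘ := K_{Z^ℚ} × K_G^∘` (p. 27), `K_H^∘` (p. 28), `K_G^m` (p. 30) = ⟨CARRIER⟩ subgroups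
  `stabGfin`/`stabGfinMod` of ★ `HermSpace.Gfin` (adelic lattices are not constructed; ★ `Sec3Data` READING R3: levels indexed by `K_G` alone).
* THE MODULI PROBLEM of §5.1 (p. 28) is a REAL structure `Obj f` over an `O_E`-scheme `f : S → Spec O_E` (`O_E = 𝓞 E`, `E` = ★ `reflexFieldOf Φ φ₀`):
  «`(A₀, ι₀, λ₀)` is an object of `M₀^ξ(S)`» = ★ `M0Obj` at `𝔟 = 𝔞 (= O_{F₀})` with ★ `label … = ξ` on connected `S` (READING R5 = ★ `objM0_label`: the
  summand condition is stated over connected test schemes); «`(A, ι)` an abelian scheme over `S` with `O_F`-action `ι` satisfying the Kottwitz condition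
  (3.11) of signature `((1, n−1)_{φ₀}, (0, n)_{φ ∈ Φ∖{φ₀}})`» = ★ `AbelianSchemeOver`, ★ `RingAction (𝓞 F)`, ★ `clauses.IsKottwitz` at ★ `signatureFn`;
  «`λ` a polarization whose Rosati involution induces on `O_F` the non-trivial Galois automorphism of `F/F₀`» = ★ `Polarization` + ★ `clauses.RosatiIsConj`.
  The two imposed conditions are predicates on `Obj`: the SIGN CONDITION (5.3) «at every point `s` of `S`, `inv^r_v(A₀,s, ι₀,s, λ₀,s, A_s, ι_s, λ_s) =
  inv_v(−W_v)` for every finite place `v` of `F₀` which is non-split in `F`» = ⟨CARRIER⟩ sign factor `signFactor` (defined in (A.5)∕(A.8) of App. A, to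
  be typed in `AppASignInvariants`) against the REAL class of `−W_v` (`hermIsSplitAt (−J_W) v`, READING R3); and «for any finite place `ν` of `E` … the triple up to isogeny prime to `p` over
  `S ×_{Spec O_E} Spec O_{E,(ν)}` … satisfies the conditions in the semi-global moduli problem for `ν` defined in Section 4» = ⟨CARRIER⟩ `SemiGlobalOK`
  (§4.1–4.4 are squad TL's ∕ unassigned: ★ `Sec4CitedRows` types Thm. 4.1's problem; not imported here).  «The morphisms in this category are the
  isomorphisms» = `Obj.Iso` (★ `M0Obj.Iso` and a REAL `O_F`-linear isomorphism `A ≅ A'` with the ★ `PolPullback` clause).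
* STACKS (READING R6).  «representable by a Deligne–Mumford stack flat over `Spec O_E`», «smooth of relative dimension `n − 1` over the open subscheme of
  `Spec O_E` obtained by removing …», «semi-stable reduction over …», «canonically isomorphic to the semi-global moduli space», «regular», «finite and flat
  over», «relatively representable over `M₀^ξ`», «normalization» are properties of DM STACKS, which have no Mathlib ∕ tree vocabulary: they are ⟨CARRIER⟩
  `Prop`-valued fields of the datum INDEXED BY REAL DATA (the level function `m` of (5.8), `m = 0` being §5.1's `K^∘`; the REAL sets of removed places of
  `E`; the relative dimension) — PLACEHOLDERS in the sense of the squad QA (no closed fact reduces to them; Theorems 5.2∕5.4 are predicates on `D`).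
  The REAL content of Thm. 5.2 (i)(ii) typed exactly is WHICH places are removed: `ν` over `v₀` with `(v₀, Λ_{v₀})` of AT type (1) or (4), resp. of AT
  type (4) or of AT type (1) with `E_ν/ℚ_p` ramified (`badSmooth`, `badSemistable`; `ν` over `v` = `LiesUnder`, REAL via `Ideal.comap` along
  `φ₀ : O_{F₀} → O_E`).
* §5.2 (p. 30): (5.7) `spl`, `spl_Φ` REAL up to the ⟨CARRIER⟩ matching condition (4.19) `Matches ν` (§4.3 p. 19, squad TL); (5.8) «a function
  `m : spl → ℤ_{≥0}` with finite support contained in `spl_Φ`» = `IsLevelFn m` (REAL); `N(m) := ∏_{v ∈ spl} p_v^{m(v)}` = `levelIdeal m` (REAL, `finprod`);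
  `K_G^m` ⟨CARRIER⟩ with the REAL axiom-free remark «if `m = 0`, then `K_G^m = K_G^∘`» typed as `Eq58_level_zero`.
* NOT TYPED (RECORDED; no carrier posited — each needs the auxiliary spaces `R_{G̃}`, `R′_{G̃}`, `R_{H̃G}`, `R′_{H̃G}` of (4.33)∕(4.34) in §4.4, «defined in
  the obvious way» (p. 30), and the stacks `M_{K^∘_{H̃}}(H̃)`, `M_{K^∘_{H̃G}}(H̃G)`, which are outside this file's single moduli problem): the closed embeddings
  **(5.5)** «`M_{K^∘_{H̃}}(H̃) ↪ M_{K^∘_{G̃}}(G̃)` and `M_{K^∘_{H̃}}(H̃) ↪ M_{K^∘_{H̃G}}(H̃G)`» (`n` odd, p. 29), the diagrams after Remark 5.3 and **(5.6)**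
  «`M_{K′^∘_{H̃}}(H̃) := M_{K^∘_{H̃}}(H̃) ×_{R_{H̃G}} R′_{H̃G} ↪ M_{K^∘_{H̃G}}(H̃G)`» (`n` even, p. 30), the smoothness∕semi-stability sentence for `M_{K^∘_{H̃}}(H̃)`,
  `M_{K^∘_{H̃G}}(H̃G)` (p. 30, lines 3–6), **(5.9)**, **(5.10)** (p. 30) and the Hecke correspondences **(5.11)** (pp. 30–31); Remark 5.1 (ii)'s
  Tate-module reformulation «`Hom_{O_F}(T_ℓ(A₀,s̄), T_ℓ(A_s̄)) ≃ −Λ_ℓ` for every prime `ℓ ≠ char κ(s̄)`» and its comparison with [7, §2.3] (p. 28); Remark 5.3's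
  existence converses («if the congruence (5.4) is satisfied, then the hermitian space `W♭` will exist and admit a lattice `Λ♭` as above»; `n` even, `F/F₀`
  ramified somewhere ⇒ `W♭` with `Λ♭` exists, p. 29) and its forward-looking paragraph («In future work …», p. 29).

## References
* [RapoportSmithlingZhang2020Diagonal] M. Rapoport, B. Smithling, W. Zhang, *Arithmetic diagonal cycles on unitary Shimura varieties*, Compos. Math. 156
  (2020) 1745–1824, arXiv:1710.06962v6 — §1 Notation pp. 5–7 ((1.3)–(1.5), lattice types); §4.3 (4.19) p. 19; §4.4 p. 22 (AT types (1)–(4)), (4.30)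
  p. 25; §5 pp. 27–31 ((5.1)–(5.11), Remark 5.1, Theorem 5.2, Remark 5.3, Theorem 5.4); App. A (A.5), (A.8) p. 56 (the sign factor `inv^r_v`).
* [RapoportSmithlingZhang2017] the arXiv v1 TeX of the same work (`paper:arxiv-1710.06962` chunk p0022) — used only to restore dropped glyphs, see above.
* [Liu2021] Y. Liu, *Fourier–Jacobi cycles and arithmetic relative trace formula*, Camb. J. Math. 9 (2021) — App. C (★ `HermSpace`; ★ `IsInert`/`IsSplit`).
-/

noncomputable section

open scoped TensorProduct Matrix MatrixGroups
open NumberField IsDedekindDomain CategoryTheory AlgebraicGeometry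
open Literature.AlgebraicGeometry.Motives (CMType)
open Literature.AlgebraicGeometry.AbelianSchemes (AbelianSchemeOver)
open Literature.NumberTheory.Automorphic.Liu2021.AppendixC (HermSpace conj)
open Literature.NumberTheory.Automorphic.Liu2021.AppendixC.SecC4IntegralModelsUniformization (IsInert IsSplit residueChar)
open Literature.AlgebraicGeometry.ShimuraVarieties.RapoportSmithlingZhang2020.Sec3IntegralModels
open Literature.AlgebraicGeometry.ShimuraVarieties.RapoportSmithlingZhang2020.Sec2GroupTheoreticSetup

namespace Literature.AlgebraicGeometry.ShimuraVarieties.RapoportSmithlingZhang2020.Sec5GlobalIntegralModels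

variable (F₀ F : Type) [Field F₀] [NumberField F₀] [IsTotallyReal F₀] [Field F] [NumberField F] [Algebra F₀ F]
  [IsTotallyComplex F] [Algebra.IsQuadraticExtension F₀ F]

/-! ## §1 Notation prerequisites (pp. 6–7): local norms, `inv_v` (1.4), split ∕ ramified places, units, lattices in coordinates (REAL) -/

/-- **«`a ∈ Nm F_v^×`»** for `a ∈ F` and a finite place `v` of `F₀` (p. 6: «`F_v := F ⊗_{F₀} F₀,v`», «`det W_v ∈ F₀,v^×/Nm F_v^×`»): `a` is a norm from
`F_v = F₀,v ⊗_{F₀} F` (Mathlib `HeightOneSpectrum.adicCompletion`), i.e. `a = z z̄` for some `z ∈ F_v`, `z̄ = (1 ⊗ c)(z)` with `c` = ★ `cbar` (for `a ∉ F₀`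
this is never satisfied, consistently).  REAL. [cite: RapoportSmithlingZhang2020Diagonal, §1 Notation (1.4) p. 6] -/
def IsNormAt (v : HeightOneSpectrum (𝓞 F₀)) (a : F) : Prop :=
  ∃ z : (v.adicCompletion F₀) ⊗[F₀] F,
    z * Algebra.TensorProduct.map (AlgHom.id F₀ (v.adicCompletion F₀)) (cbar F₀ F) z = (1 : v.adicCompletion F₀) ⊗ₜ[F₀] a

/-- **The hermitian form in coordinates** for a Gram matrix `J ∈ M_κ(F)` with the ★ `HermSpace.gram` convention `J i j = (e_j, e_i)` (form `F`-linear in the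
first variable and conjugate-linear in the second, p. 6): `(x, y) = Σ_{i,j} x_i ȳ_j J_{ji}`.  REAL. [cite: RapoportSmithlingZhang2020Diagonal, §1 Notation p. 6] -/
def hermForm {κ : Type} [Fintype κ] (J : Matrix κ κ F) (x y : κ → F) : F :=
  ∑ i, ∑ j, x i * conj F₀ F (y j) * J j i

/-- **«`W_v` is split at a finite place `v` if `inv_v(W_v) = 1`»**, with **(1.4)** «`inv_v(W_v) := (−1)^{n(n−1)/2} det W_v ∈ F₀,v^×/Nm F_v^×`», «`det W` … the
class of `det J`, where `J` is any hermitian matrix representing the form» (p. 6) — for the space with Gram matrix `J ∈ M_κ(F)`, `n = #κ`.  REAL (via `IsNormAt`).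
[cite: RapoportSmithlingZhang2020Diagonal, §1 Notation (1.4) p. 6] -/
def hermIsSplitAt {κ : Type} [Fintype κ] [DecidableEq κ] (J : Matrix κ κ F) (v : HeightOneSpectrum (𝓞 F₀)) : Prop :=
  IsNormAt F₀ F v ((-1 : F) ^ (Fintype.card κ * (Fintype.card κ - 1) / 2) * J.det)

/-- **«`v` ramifies in `F`»** (pp. 6, 27) for a finite place `v` of `F₀`: `v` is neither split nor inert in the quadratic extension `F/F₀` (★
`Liu2021…SecC4.IsSplit`, ★ `IsInert`).  REAL. [cite: RapoportSmithlingZhang2020Diagonal, §1 Notation p. 6] -/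
def IsRamifiedPlace (v : HeightOneSpectrum (𝓞 F₀)) : Prop :=
  ¬ IsSplit F v ∧ ¬ IsInert F v

/-- **«ramified over `ℚ`»** ∕ negation of «unramified over `ℚ`» for a finite place `𝔭` of a number field `K` (conditions (1), (2) p. 27; «`E_ν` is ramified over
`ℚ_p`», Thm. 5.2 (ii) p. 28): the ramification index of `𝔭` over `ℤ` is not `1` (Mathlib `Ideal.ramificationIdx`).  REAL.
[cite: RapoportSmithlingZhang2020Diagonal, §5.1 p. 27] -/
def IsRamifiedOverQ {K : Type} [Field K] (𝔭 : HeightOneSpectrum (𝓞 K)) : Prop :=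
  𝔭.asIdeal.ramificationIdx ℤ ≠ 1

/-- **«of degree one over `ℚ`»** for a finite place `𝔭` of a number field `K` (p. 29: «we assume that each `v_i` is of degree one over `ℚ`»): `[K_𝔭 : ℚ_p] = 1`,
i.e. ramification index and inertia degree over `ℤ` both equal `1` (Mathlib `Ideal.ramificationIdx`, `Ideal.inertiaDeg`).  REAL.
[cite: RapoportSmithlingZhang2020Diagonal, §5.1 p. 29] -/
def IsDegreeOneOverQ {K : Type} [Field K] (𝔭 : HeightOneSpectrum (𝓞 K)) : Prop :=
  𝔭.asIdeal.ramificationIdx ℤ = 1 ∧ 𝔭.asIdeal.inertiaDeg ℤ = 1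

/-- **«`(u,u)` is a unit at `v`»** ∕ **«`ord_v(u,u) = 1`»** (p. 29) for `a ∈ F` and a finite place `v` of `F₀`, read at the primes `w` of `F` above `v` (★
`UnitaryGroup.PlacesOver`; Mathlib `HeightOneSpectrum.valuation`, multiplicative with values `ℤₘ₀`): `IsUnitAt` = valuation `1` at every `w ∣ v`.  REAL.
[cite: RapoportSmithlingZhang2020Diagonal, §5.1 p. 29] -/
def IsUnitAt (v : HeightOneSpectrum (𝓞 F₀)) (a : F) : Prop :=
  ∀ w : Literature.NumberTheory.Automorphic.UnitaryGroup.PlacesOver F v, w.1.valuation F a = 1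

/-- **«`ord_v(u,u) = 1`»** (p. 29) for `a ∈ F` at a finite place `v` of `F₀`: valuation `ofAdd (−1)` at every prime `w` of `F` above `v` (Mathlib
`HeightOneSpectrum.valuation`, multiplicative `ℤₘ₀`; for `v` inert, the printed case, `w` is unique and unramified so `ord_w = ord_v`).  REAL.
[cite: RapoportSmithlingZhang2020Diagonal, §5.1 p. 29] -/
def HasOrdOneAt (v : HeightOneSpectrum (𝓞 F₀)) (a : F) : Prop :=
  ∀ w : Literature.NumberTheory.Automorphic.UnitaryGroup.PlacesOver F v,
    w.1.valuation F a = ((Multiplicative.ofAdd (-1 : ℤ) : Multiplicative ℤ) : WithZero (Multiplicative ℤ))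

/-- **«`Λ^∨`, the dual lattice with respect to the hermitian form»** (pp. 6–7), through membership: `x ∈ Λ^∨` iff «`(x, y) ∈ O_F` for all `y ∈ Λ`», for a
lattice `Λ` in the coordinate space `κ → F` with Gram matrix `J` (READING R2).  REAL. [cite: RapoportSmithlingZhang2020Diagonal, §1 Notation pp. 6–7] -/
def InDual {κ : Type} [Fintype κ] (J : Matrix κ κ F) (L : Submodule (𝓞 F) (κ → F)) (x : κ → F) : Prop :=
  ∀ y ∈ L, ∃ a : 𝓞 F, hermForm F₀ F J x y = (a : F)

/-! ## Squad dedup bridge R-6 (T-ref6 N2): RSZ's `IsSimil`∕`GQ` (§2) vs KR2013's ★ `GU σ J` (§4.1) -/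

/-- **Dedup bridge N2 (squad ruling R-6).**  The similitude identity of ★ `Sec2GroupTheoreticSetup.IsSimil` (RSZ §2.1 p. 7: «`c` the similitude factor of a
point on a unitary similitude group», points of `G^ℚ ⊂ Res_{F₀/ℚ} GU(W)` carried with their multiplier) is membership in TKR-t02's ★ `KudlaRapoport2013.…GU σ J`
(the graph-of-multiplier set `{(g, ν) ∣ σ ν = ν, (gσ)ᵀ J g = ν J}`) in the ambient `F ⊗_{F₀} (F₀ ⊗_ℚ R)` with `σ = c ⊗ 1` (★ `cR`) and `J ⊗ 1` (★ `UnitaryScheme.baseForm`);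
the `σ`-fixed clause of `GU` is automatic for `ν = ofR c`, `c ∈ Rˣ`.  Provable by unfolding; stated so that no third similitude carrier is introduced in the
squad's files. [cite: RapoportSmithlingZhang2020Diagonal, §2.1 p. 7] [cite: KudlaRapoport2013, §4.1 (arXiv v2 p. 19)] -/
def RSZ2020_2_IsSimil_iff_mem_GU : Prop :=
  ∀ (R : Type) [CommRing R] [Algebra ℚ R] {κ : Type} [Fintype κ] [DecidableEq κ] (J : Matrix κ κ F)
    (g : GL κ (ER F₀ F R)) (c : Rˣ),
    IsSimil F₀ F R J g c ↔
      (g, Units.map ((ofR F₀ F R : R →+* ER F₀ F R) : R →* ER F₀ F R) c) ∈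
        KudlaRapoport2013.Sec4RelationToShimuraVarieties.GU ((cR F₀ F R : ER F₀ F R →ₐ[F₀] ER F₀ F R) : ER F₀ F R →+* ER F₀ F R)
          (Literature.NumberTheory.Automorphic.UnitaryScheme.baseForm F₀ F κ J (AR F₀ R))

/-! ## (5.1) (p. 27): `V_AT^W`, `q_v`, `𝔡_AT^W` (REAL, READING R4) -/

/-- **«`q_v` the (unique) prime in `O_F` determined by `v ∈ V_AT^W`»** (p. 27): the radical of `p_v O_F` — the product of the distinct primes of `O_F` above
`v`, which IS the unique prime `q_v` above `v` when `v` is inert or ramified (READING R4; junk = `q q'` at split `v`, never used).  REAL.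
[cite: RapoportSmithlingZhang2020Diagonal, §5.1 (5.1) p. 27] -/
def qOf (v : HeightOneSpectrum (𝓞 F₀)) : Ideal (𝓞 F) :=
  (v.asIdeal.map (algebraMap (𝓞 F₀) (𝓞 F))).radical

/-- **(5.1)** «`V_AT^W := {v ∣ v is either inert in F and W_v is non-split, or v ramifies in F}`», «the following finite set of finite places of `F₀`» (p. 27),
for the hermitian space with Gram matrix `J` (READING R2: `J = J_W` = ★ `gramW`, or `J = J_{W♭}` = ★ `Wflat.gram` for `V_AT^{W♭}`, p. 28).  REAL.
[cite: RapoportSmithlingZhang2020Diagonal, §5.1 (5.1) p. 27] -/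
def VAT {κ : Type} [Fintype κ] [DecidableEq κ] (J : Matrix κ κ F) : Set (HeightOneSpectrum (𝓞 F₀)) :=
  {v | (IsInert F v ∧ ¬ hermIsSplitAt F₀ F J v) ∨ IsRamifiedPlace F₀ F v}

/-- «`𝔡_AT^W := ∏_{v ∈ V_AT^W} q_v ⊂ O_F`» (p. 27, display after (5.1)), as a finite product of ideals (Mathlib `finprod`; the printed `V_AT^W` is finite).  REAL.
[cite: RapoportSmithlingZhang2020Diagonal, §5.1 (5.1) p. 27] -/
def dAT {κ : Type} [Fintype κ] [DecidableEq κ] (J : Matrix κ κ F) : Ideal (𝓞 F) :=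
  ∏ᶠ v ∈ VAT F₀ F J, qOf F₀ F v

/-! ## (5.7) `spl` and `N(m)` (p. 30; REAL, datum-independent) -/

/-- **(5.7)**, first set: «`spl := {places v of F₀ ∣ v splits in F}`» (p. 30).  REAL (★ `IsSplit`). [cite: RapoportSmithlingZhang2020Diagonal, §5.2 (5.7) p. 30] -/
def spl : Set (HeightOneSpectrum (𝓞 F₀)) :=
  {v | IsSplit F v}

/-- «`N(m) := ∏_{v ∈ spl} p_v^{m(v)}`» (p. 30), an ideal of `O_{F₀}` (Mathlib `finprod`; `p_v` = `v.asIdeal`, Notation p. 6; the factors with `m(v) = 0` are `1`).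
REAL. [cite: RapoportSmithlingZhang2020Diagonal, §5.2 p. 30] -/
def levelIdeal (m : HeightOneSpectrum (𝓞 F₀) → ℕ) : Ideal (𝓞 F₀) :=
  ∏ᶠ v ∈ spl F₀ F, v.asIdeal ^ m v

/-! ## The datum of §5 (READING R1): ★ `Sec3Data` with `𝔞 = O_{F₀}` + ★ `Sec2Datum` (`W♭`) + the lattices, the standing hypotheses, and the ⟨CARRIER⟩s -/

/-- **The datum of [RSZ2020] §5** (pp. 27–30).  ★ `Sec3Data` (§3: `F/F₀` CM, `Φ`, `W`, `φ₀`, `u`, `𝔞`, `ξ`, the ⟨CARRIER⟩ clause predicates and moduli groupoids) with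
«`𝔞 = O_{F₀}`» (p. 27), merged with ★ `Sec2Datum` (§2: `W♭ = u^⊥`, same `W`, `u`); the REAL lattices `Λ ⊂ W` (adapted coordinates, READING R2) and `Λ♭ ⊂ W♭`
with the standing hypotheses «We fix an `O_F`-lattice `Λ` in `W` with (5.2) `Λ ⊂ Λ^∨ ⊂ (𝔡_AT^W)^{-1}Λ`. We assume that the triple `(F/F₀, W, Λ)` satisfies the
following conditions. (1) All finite places `v` of `F₀` ramified over `ℚ` or dividing `2` are split in `F`. (2) All places `v ∈ V_AT^W` are unramified over `ℚ`,
and the pair `(v, Λ_v)` is isomorphic to one of the AT types (1)–(4) in Section 4.4» (p. 27) as `Prop` FIELDS; and the ⟨CARRIER⟩ local lattice types (p. 7),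
level subgroups (pp. 27, 30), sign factor (5.3)∕(A.5)∕(A.8), semi-global conditions (§4), matching condition (4.19), local equality of lattices, relation
(4.30), and stack properties (READING R6).  Nothing is asserted; a consumer supplies the datum.
[cite: RapoportSmithlingZhang2020Diagonal, §5.1 pp. 27–28 and §5.2 p. 30] -/
structure Sec5Data : Type 2 extends Sec3Data F₀ F, Sec2Datum F₀ F where
  /-- «We will take `𝔞 = O_{F₀}`, i.e., we will assume that `M₀ = M₀^{O_{F₀}}` is non-empty» (p. 27): the ideal of ★ `Sec3Data` is the unit ideal. -/
  𝔞_eq_top : 𝔞 = ⊤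
  /-- ⟨CARRIER⟩ **«vertex lattice of type `r`»** (p. 7: «`Λ` an `O_{F,v}`-lattice in an `F_v/F₀,v`-hermitian space … we call `Λ` a vertex lattice of type `r` if
  `Λ ⊂^r Λ^∨ ⊂ π_v^{-1} Λ`», «`M ⊂^r N` … an `R`-submodule of finite colength `r`», p. 6), for the completion `Λ ⊗_{O_F} O_{F,v}` at `v` of a GLOBAL lattice `Λ`
  in the coordinate space with Gram matrix `J`; «self-dual» = type `0`, «almost self-dual» = type `1` (p. 7). -/
  IsVertexTypeAt : ∀ {κ : Type} [Fintype κ], Matrix κ κ F → Submodule (𝓞 F) (κ → F) → HeightOneSpectrum (𝓞 F₀) → ℕ → Prop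
  /-- ⟨CARRIER⟩ **«`π_v`-modular»** (p. 7: «a vertex lattice `Λ` is `π_v`-modular if `Λ^∨ = π_v^{-1}Λ`»), at `v`, for the completion of a global lattice. -/
  IsPiModularAt : ∀ {κ : Type} [Fintype κ], Matrix κ κ F → Submodule (𝓞 F) (κ → F) → HeightOneSpectrum (𝓞 F₀) → Prop
  /-- ⟨CARRIER⟩ **«almost `π_v`-modular»** (p. 7: «if `Λ ⊂ Λ^∨ ⊂^1 π_v^{-1}Λ`»), at `v`, for the completion of a global lattice. -/
  IsAlmostPiModularAt : ∀ {κ : Type} [Fintype κ], Matrix κ κ F → Submodule (𝓞 F) (κ → F) → HeightOneSpectrum (𝓞 F₀) → Prop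
  /-- ⟨CARRIER⟩ **local equality of lattices at `v`**: «`Λ_v = Λ′_v`» for two global lattices in the same coordinate space (used in «`Λ_v = Λ♭_v ⊕ O_{F,v} u`»,
  p. 29, READING R2). -/
  LocallyEqAt : ∀ {κ : Type}, Submodule (𝓞 F) (κ → F) → Submodule (𝓞 F) (κ → F) → HeightOneSpectrum (𝓞 F₀) → Prop
  /-- ⟨CARRIER⟩ **relation (4.30) at a ramified place** (§4.4 p. 25) between `Λ_v` and `Λ♭_v` — the clause «`Λ_{v_i}` is one of the two lattices for which the
  relation (4.30) holds with `v_i` in place of `v₀`» (p. 29); (4.30) itself is in squad TL's ∕ unassigned §4.4 and is not restated here. -/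
  Rel430At : Submodule (𝓞 F) (Fin Wflat.n ⊕ Unit → F) → Submodule (𝓞 F) (Fin Wflat.n → F) → HeightOneSpectrum (𝓞 F₀) → Prop
  /-- «We fix an `O_F`-lattice `Λ` in `W`» (p. 27): an `O_F`-submodule of the adapted coordinate space of `W = W♭ ⊕ F u` (READING R2). -/
  Λ : Submodule (𝓞 F) (Fin Wflat.n ⊕ Unit → F)
  /-- «lattice»: finitely generated … -/
  Λ_fg : Λ.FG
  /-- … and spanning `W` over `F`. -/
  Λ_span : Submodule.span F (Λ : Set (Fin Wflat.n ⊕ Unit → F)) = ⊤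
  /-- **(5.2)**, first inclusion «`Λ ⊂ Λ^∨`» (p. 27): the form is `O_F`-valued on `Λ` (Gram matrix ★ `gramW` of the adapted basis). -/
  Λ_integral : ∀ x ∈ Λ, InDual F₀ F (Sec2Datum.gramW toSec2Datum) Λ x
  /-- **(5.2)**, second inclusion «`Λ^∨ ⊂ (𝔡_AT^W)^{-1}Λ`» (p. 27): `𝔡_AT^W · Λ^∨ ⊂ Λ`. -/
  Λ_dual_le : ∀ x : Fin Wflat.n ⊕ Unit → F, InDual F₀ F (Sec2Datum.gramW toSec2Datum) Λ x →
    ∀ d ∈ dAT F₀ F (Sec2Datum.gramW toSec2Datum), d • x ∈ Λ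
  /-- «choosing a lattice `Λ♭ ⊂ W♭` analogously to above» (p. 28): an `O_F`-submodule of the coordinate space of `W♭` (★ `Wflat.basis`; READING R2). -/
  Λflat : Submodule (𝓞 F) (Fin Wflat.n → F)
  /-- `Λ♭` is finitely generated … -/
  Λflat_fg : Λflat.FG
  /-- … and spans `W♭`. -/
  Λflat_span : Submodule.span F (Λflat : Set (Fin Wflat.n → F)) = ⊤
  /-- «analogously to above» (p. 28): (5.2) for `Λ♭`, first inclusion `Λ♭ ⊂ Λ♭^∨`. -/
  Λflat_integral : ∀ x ∈ Λflat, InDual F₀ F Wflat.gram Λflat x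
  /-- (5.2) for `Λ♭`, second inclusion `Λ♭^∨ ⊂ (𝔡_AT^{W♭})^{-1}Λ♭`. -/
  Λflat_dual_le : ∀ x : Fin Wflat.n → F, InDual F₀ F Wflat.gram Λflat x → ∀ d ∈ dAT F₀ F Wflat.gram, d • x ∈ Λflat
  /-- **Condition (1)** (p. 27): «All finite places `v` of `F₀` ramified over `ℚ` or dividing `2` are split in `F`.»  REAL. -/
  cond1 : ∀ v : HeightOneSpectrum (𝓞 F₀), (IsRamifiedOverQ v ∨ residueChar v = 2) → IsSplit F v
  /-- **Condition (2)** (p. 27; v6 wording): «All places `v ∈ V_AT^W` are unramified over `ℚ`, and the pair `(v, Λ_v)` is isomorphic to one of the AT types (1)–(4) in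
  Section 4.4», the AT types quoted from p. 22: «(1) `v` is inert in `F` and `Λ_v` is almost self-dual as an `O_{F,v}`-lattice. (2) `v` ramifies in `F`, `n` is even,
  and `Λ_v` is `π_v`-modular. (3) `v` ramifies in `F`, `n` is odd, and `Λ_v` is almost `π_v`-modular. (4) `v` ramifies in `F`, `n = 2`, and `Λ_v` is self-dual.»
  (REAL except the lattice-type carriers.) -/
  cond2 : ∀ v ∈ VAT F₀ F (Sec2Datum.gramW toSec2Datum), ¬ IsRamifiedOverQ v ∧
    ((IsInert F v ∧ IsVertexTypeAt (Sec2Datum.gramW toSec2Datum) Λ v 1) ∨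
     (IsRamifiedPlace F₀ F v ∧ Even W.n ∧ IsPiModularAt (Sec2Datum.gramW toSec2Datum) Λ v) ∨
     (IsRamifiedPlace F₀ F v ∧ Odd W.n ∧ IsAlmostPiModularAt (Sec2Datum.gramW toSec2Datum) Λ v) ∨
     (IsRamifiedPlace F₀ F v ∧ W.n = 2 ∧ IsVertexTypeAt (Sec2Datum.gramW toSec2Datum) Λ v 0))
  /-- ⟨CARRIER⟩ **`K_G^∘ := {g ∈ G(𝔸_{F₀,f}) ∣ g(Λ ⊗_{O_F} Ô_F) = Λ ⊗_{O_F} Ô_F}`** (p. 27) and **`K_H^∘ ⊂ H(𝔸_{F₀,f})` «the stabilizer of `Λ♭ ⊗_{O_F} Ô_F`»** (p. 28):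
  the stabilizer in ★ `HermSpace.Gfin` of the adelic completion of a global lattice (not constructed here). -/
  stabGfin : ∀ (V : HermSpace F₀ F) {κ : Type}, Submodule (𝓞 F) (κ → F) → Subgroup V.Gfin
  /-- ⟨CARRIER⟩ **`K_G^m := {g ∈ G(𝔸_{F₀,f}) ∣ g(Λ ⊗_{O_F} Ô_F) = Λ ⊗_{O_F} Ô_F and g ≡ id mod N(m)}`** (p. 30), for an ideal `N ⊂ O_{F₀}` in place of `N(m)`. -/
  stabGfinMod : ∀ (V : HermSpace F₀ F) {κ : Type}, Submodule (𝓞 F) (κ → F) → Ideal (𝓞 F₀) → Subgroup V.Gfin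
  /-- ⟨CARRIER⟩ **the sign factor `inv^r_v(A₀,s, ι₀,s, λ₀,s, A_s, ι_s, λ_s) ∈ {±1}`** of (5.3) (p. 28; = (4.4) p. 16: «the left-hand side is the sign factor defined in
  (A.5) and (A.8) in Appendix A»), at a point `s` of the base of a tuple `(A₀, ι₀, λ₀; A, ι, λ)` over an `O_E`-scheme, for a finite place `v` of `F₀`. -/
  signFactor : ∀ {S : Scheme.{0}} (f : S ⟶ Spec (.of (𝓞 (reflexFieldOf Φ φ₀)))),
    M0Obj F₀ F clauses 𝔞 f → ∀ (A : AbelianSchemeOver S), A.RingAction (𝓞 F) → ∀ (Dp : A.DualPair), A.Polarization Dp →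
      HeightOneSpectrum (𝓞 F₀) → S → ℤˣ
  /-- ⟨CARRIER⟩ **the semi-global conditions at `ν`** (p. 28): «for any finite place `ν` of `E`, denoting by `p` its residue characteristic, the triple up to isogeny
  prime to `p` over `S ×_{Spec O_E} Spec O_{E,(ν)}`, `(A ⊗ ℤ_{(p)}, ι ⊗ ℤ_{(p)}, λ ⊗ ℤ_{(p)})`, satisfies the conditions in the semi-global moduli problem for `ν`
  defined in Section 4» (§4.1, 4.2 or 4.4 according to the type of `(v₀, Λ_{v₀})`; squad TL's ★ `Sec4CitedRows` types §4.1's). -/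
  SemiGlobalOK : HeightOneSpectrum (𝓞 (reflexFieldOf Φ φ₀)) → ∀ {S : Scheme.{0}} (f : S ⟶ Spec (.of (𝓞 (reflexFieldOf Φ φ₀)))),
    M0Obj F₀ F clauses 𝔞 f → ∀ (A : AbelianSchemeOver S), A.RingAction (𝓞 F) → ∀ (Dp : A.DualPair), A.Polarization Dp → Prop
  /-- ⟨CARRIER⟩ **the matching condition (4.19)** between `Φ` and a place `ν` of `E` (§4.3 p. 19: «`{φ ∈ Hom(F, ℚ̄) ∣ w_φ = w₀} ⊂ Φ` … we also say that the CM
  type `Φ` and the place `ν` of `E` are matched»), used in (5.7). -/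
  Matches : HeightOneSpectrum (𝓞 (reflexFieldOf Φ φ₀)) → Prop
  /-- ⟨CARRIER⟩ STACK PROPERTY (READING R6): «the moduli problem [at level `K^m_{G̃} = K_{Z^ℚ} × K^m_G`] is representable by a Deligne–Mumford stack flat over
  `Spec O_E`» (Thm. 5.2 p. 28 for `m = 0`, i.e. `K^∘`; §5.2 p. 30 for general `m`), indexed by the level function `m` of (5.8). -/
  IsReprFlatDM : (HeightOneSpectrum (𝓞 F₀) → ℕ) → Prop
  /-- ⟨CARRIER⟩ STACK PROPERTY: «for every [finite] place `ν` of `E`, the base change `M ×_{Spec O_E} Spec O_{E,(ν)}` is canonically isomorphic to [variants of]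
  the semi-global moduli space defined in one of Sections 4.1, 4.2 [∕ 4.3], or 4.4» (Thm. 5.2 p. 28; Thm. 5.4 p. 30), at level `m`. -/
  BaseChangeSemiGlobal : (HeightOneSpectrum (𝓞 F₀) → ℕ) → HeightOneSpectrum (𝓞 (reflexFieldOf Φ φ₀)) → Prop
  /-- ⟨CARRIER⟩ STACK PROPERTY: «`M` is smooth of relative dimension `d` over the open subscheme of `Spec O_E` obtained by removing all places» in the REAL set `T`
  (Thm. 5.2 (i) p. 28), at level `m`. -/
  IsSmoothOff : (HeightOneSpectrum (𝓞 F₀) → ℕ) → Set (HeightOneSpectrum (𝓞 (reflexFieldOf Φ φ₀))) → ℕ → Prop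
  /-- ⟨CARRIER⟩ STACK PROPERTY: «`M` has semi-stable reduction over the open subscheme of `Spec O_E` obtained by removing all places» in the REAL set `T`
  (Thm. 5.2 (ii) p. 28), at level `m`. -/
  IsSemistableOff : (HeightOneSpectrum (𝓞 F₀) → ℕ) → Set (HeightOneSpectrum (𝓞 (reflexFieldOf Φ φ₀))) → Prop
  /-- ⟨CARRIER⟩ STACK PROPERTY: «`M_{K^m_{G̃}}(G̃)` [the normalization of `M_{K^∘_{G̃}}(G̃)` in the generic-fibre stack `M_{K^m_{G̃}}(G̃)` of §3.2] is a regular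
  Deligne–Mumford stack finite and flat over `M_{K^∘_{G̃}}(G̃)`» (Thm. 5.4 p. 30), at level `m`. -/
  IsRegularFiniteFlatOverLevelZero : (HeightOneSpectrum (𝓞 F₀) → ℕ) → Prop
  /-- ⟨CARRIER⟩ STACK PROPERTY: «`M_{K^m_{G̃}}(G̃)` is relatively representable over `M₀^ξ`» (Thm. 5.4 p. 30), at level `m`. -/
  IsRelReprOverM0 : (HeightOneSpectrum (𝓞 F₀) → ℕ) → Prop

namespace Sec5Data

variable {F₀ F}
variable (D : Sec5Data F₀ F)

/-- «`ν` … denoting by `v₀` the place of `F₀` induced by `ν` via `φ₀`» (pp. 27–28): the finite place `ν` of `E` lies over the finite place `v` of `F₀` along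
`φ₀ : F₀ ⊂ F → E` (★ `phi0ToReflexFieldOf`; Mathlib `RingOfIntegers.mapRingHom`, `Ideal.comap`).  REAL. [cite: RapoportSmithlingZhang2020Diagonal, §5.1 p. 27] -/
def LiesUnder (ν : HeightOneSpectrum (𝓞 D.E)) (v : HeightOneSpectrum (𝓞 F₀)) : Prop :=
  v.asIdeal = Ideal.comap (RingOfIntegers.mapRingHom ((phi0ToReflexFieldOf D.Φ D.φ₀).comp (algebraMap F₀ F))) ν.asIdeal

/-- **AT type `(k)` of the pair `(v, Λ_v)`**, `k ∈ {1, 2, 3, 4}` (§4.4 p. 22, quoted in `Sec5Data.cond2`), for the datum's `Λ ⊂ W` (Gram matrix ★ `gramW`): REAL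
clauses (`v` inert ∕ ramified, parity of `n`, `n = 2`) over the ⟨CARRIER⟩ lattice types; `False` for other `k`. [cite: RapoportSmithlingZhang2020Diagonal, §4.4 p. 22] -/
def IsATType (k : ℕ) (v : HeightOneSpectrum (𝓞 F₀)) : Prop :=
  (k = 1 ∧ IsInert F v ∧ D.IsVertexTypeAt D.gramW D.Λ v 1) ∨
  (k = 2 ∧ IsRamifiedPlace F₀ F v ∧ Even D.W.n ∧ D.IsPiModularAt D.gramW D.Λ v) ∨
  (k = 3 ∧ IsRamifiedPlace F₀ F v ∧ Odd D.W.n ∧ D.IsAlmostPiModularAt D.gramW D.Λ v) ∨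
  (k = 4 ∧ IsRamifiedPlace F₀ F v ∧ D.W.n = 2 ∧ D.IsVertexTypeAt D.gramW D.Λ v 0)

/-- **`K_G^∘`** (p. 27) for the datum: the ⟨CARRIER⟩ stabilizer of `Λ ⊗ Ô_F` in `G(𝔸_{F₀,f})` = ★ `W.Gfin`; «and as usual we define `K_{G̃}^∘ := K_{Z^ℚ} × K_G^∘`» (★
`Sec3Data` READING R3: the fixed factor `K_{Z^ℚ}` of (3.7) is not repeated). [cite: RapoportSmithlingZhang2020Diagonal, §5.1 p. 27] -/
abbrev KG : Subgroup D.W.Gfin := D.stabGfin D.W D.Λ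

/-- **`K_H^∘ ⊂ H(𝔸_{F₀,f})`**, «the stabilizer of `Λ♭ ⊗_{O_F} Ô_F`» (p. 28), ⟨CARRIER⟩ in ★ `Wflat.Gfin`; `K^∘_{H̃} := K_{Z^ℚ} × K_H^∘`, `K^∘_{H̃G} := K_{Z^ℚ} × K_H^∘ × K_G^∘` (p. 28).
[cite: RapoportSmithlingZhang2020Diagonal, §5.1 p. 28] -/
abbrev KH : Subgroup D.Wflat.Gfin := D.stabGfin D.Wflat D.Λflat

/-- **«`Λ♭ ⊕ O_F u`»** (p. 29) as an `O_F`-submodule of the adapted coordinate space `Fin (n−1) ⊕ Unit → F` of `W = W♭ ⊕ F u` (READING R2): the vectors whose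
`W♭`-part lies in `Λ♭` (★ `Wflat.basis` coordinates) and whose `u`-coordinate lies in `O_F` (Mathlib `Submodule.comap`, `LinearMap.funLeft`, `LinearMap.proj`,
`1 = O_F ⊂ F`).  REAL. [cite: RapoportSmithlingZhang2020Diagonal, §5.1 p. 29] -/
def flatPlusU : Submodule (𝓞 F) (Fin D.Wflat.n ⊕ Unit → F) :=
  Submodule.comap (LinearMap.funLeft (𝓞 F) F Sum.inl) D.Λflat ⊓
    Submodule.comap (LinearMap.proj (Sum.inr ())) (1 : Submodule (𝓞 F) F)

/-! ## §5.1 (p. 28): the moduli problem over `Spec O_E` (REAL objects over the ★ carriers of §3), the sign condition (5.3), morphisms -/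

/-- **A tuple `(A₀, ι₀, λ₀, A, ι, λ)` of the §5.1 moduli problem over an `O_E`-scheme `f : S → Spec O_E`** (p. 28): «`(A₀, ι₀, λ₀)` is an object of `M₀^ξ(S)`»
(★ `M0Obj` at `𝔟 = 𝔞 = O_{F₀}`, with ★ `label = ξ` over connected `S`, READING R5); «`(A, ι)` is an abelian scheme over `S`, with `O_F`-action `ι` satisfying the
Kottwitz condition (3.11) of signature `((1, n−1)_{φ₀}, (0, n)_{φ ∈ Φ∖{φ₀}})`» (★ `clauses.IsKottwitz` at ★ `signatureFn` = (3.14)); «`λ` is a polarization whose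
Rosati involution induces on `O_F` the non-trivial Galois automorphism of `F/F₀`» (★ `clauses.RosatiIsConj`).  The two IMPOSED conditions (5.3) and the
semi-global conditions are the predicates `SignCond`, `IsObj` below.  REAL over ★ carriers. [cite: RapoportSmithlingZhang2020Diagonal, §5.1 p. 28] -/
structure Tuple {S : Scheme.{0}} (f : S ⟶ Spec (.of (𝓞 D.E))) : Type 1 where
  /-- «`(A₀, ι₀, λ₀)` is an object of `M₀^ξ(S)`»: an object of `M₀ = M₀^{O_{F₀}}` (★ `M0Obj`, `𝔞 = ⊤` by `𝔞_eq_top`) … -/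
  M0 : D.M0 D.𝔞 f
  /-- … lying in the summand `M₀^ξ` (★ `label`, over connected `S`; READING R5). -/
  label_eq : ∀ [ConnectedSpace S], D.label D.𝔞 D.𝔞_ne_bot f M0 = D.ξ
  /-- «`A` an abelian scheme over `S`» (★ `AbelianSchemeOver`). -/
  A : AbelianSchemeOver S
  /-- «with `O_F`-action `ι`» (★ `RingAction (𝓞 F)`). -/
  ι : A.RingAction (𝓞 F)
  /-- the dual pair carrying `λ` (★ `DualPair`). -/
  Dp : A.DualPair
  /-- «`λ` a polarization» (★ `Polarization`). -/
  pol : A.Polarization Dp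
  /-- «satisfying the Kottwitz condition (3.11) of signature `((1, n−1)_{φ₀}, (0, n)_{φ ∈ Φ∖{φ₀}})`» (★ carrier at ★ `signatureFn`). -/
  kottwitz : D.clauses.IsKottwitz f A ι D.signatureFn
  /-- «whose Rosati involution induces on `O_F` the non-trivial Galois automorphism of `F/F₀`» (★ carrier). -/
  rosati : D.clauses.RosatiIsConj A Dp pol ι

namespace Tuple

variable {D} {S : Scheme.{0}} {f : S ⟶ Spec (.of (𝓞 D.E))}

/-- **The sign condition (5.3)** (p. 28): «at every point `s` of `S`, `inv^r_v(A₀,s, ι₀,s, λ₀,s, A_s, ι_s, λ_s) = inv_v(−W_v)` for every finite place `v` of `F₀`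
which is non-split in `F`» — ⟨CARRIER⟩ `signFactor ∈ {±1}` against the REAL class `inv_v(−W_v)` ((1.4); `−W` has Gram matrix `−J_W`, p. 6), READING R3:
both sides live in a group of order ≤ 2, so the printed equality is typed as «`inv^r_v(…)(s) = +1` iff `−W_v` is split at `v`» (`hermIsSplitAt (−J_W) v`).
[cite: RapoportSmithlingZhang2020Diagonal, §5.1 (5.3) p. 28] -/
def SignCond (X : D.Tuple f) : Prop :=
  ∀ v : HeightOneSpectrum (𝓞 F₀), ¬ IsSplit F v →
    ∀ s : S, D.signFactor f X.M0 X.A X.ι X.Dp X.pol v s = 1 ↔ hermIsSplitAt F₀ F (-D.gramW) v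

/-- **The objects of the §5.1 moduli problem** (p. 28): a tuple on which «We impose the sign condition (5.3)» and «Furthermore, we impose that for any finite place
`ν` of `E` … [the semi-global conditions of Section 4]» (⟨CARRIER⟩ `SemiGlobalOK`). [cite: RapoportSmithlingZhang2020Diagonal, §5.1 p. 28] -/
def IsObj (X : D.Tuple f) : Prop :=
  X.SignCond ∧ ∀ ν : HeightOneSpectrum (𝓞 D.E), D.SemiGlobalOK ν f X.M0 X.A X.ι X.Dp X.pol

/-- **«The morphisms in this category are the isomorphisms»** (p. 28): an isomorphism `(A₀, ι₀, λ₀) ≅ (A₀', ι₀', λ₀')` in `M₀(S)` (★ `M0Obj.Iso`) and an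
`O_F`-linear isomorphism `A ≅ A'` of `S`-schemes under which `λ'` pulls back to `λ` (★ carrier `PolPullback`) — the shape of the morphisms of §3.2 ∕ §4.1.
[cite: RapoportSmithlingZhang2020Diagonal, §5.1 p. 28] -/
def Iso (X Y : D.Tuple f) : Prop :=
  M0Obj.Iso X.M0 Y.M0 ∧
    ∃ e : X.A.X ≅ Y.A.X, (∀ a : 𝓞 F, e.hom ≫ Y.ι.i a = X.ι.i a ≫ e.hom) ∧ D.clauses.PolPullback e X.pol Y.pol

end Tuple

/-- **[RSZ2020, Remark 5.1 (i)]** (p. 28): «Suppose that `n` is even. Then when `v` is a finite place of `F₀` inert (resp., ramified) in `F`, the two isometry types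
of the `n`-dimensional `F_v/F₀,v`-hermitian spaces are distinguished by whether they contain a self-dual (resp., `π_v`-modular) lattice. This implies that when
there are no places `v` such that the pair `(v, Λ_v)` above is of AT type (4), the sign condition (5.3) is automatically satisfied.» — typed as the second sentence
(READING R7: «automatically satisfied» = holds for every tuple satisfying the other imposed conditions); the first sentence (local hermitian lattice theory) is
its printed reason and is recorded.  Named fact (predicate on the datum). [cite: RapoportSmithlingZhang2020Diagonal, §5.1 Remark 5.1 (i) p. 28] -/
def Rem51_i : Prop :=
  Even D.W.n → (∀ v : HeightOneSpectrum (𝓞 F₀), ¬ D.IsATType 4 v) →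
    ∀ {S : Scheme.{0}} (f : S ⟶ Spec (.of (𝓞 D.E))) (X : D.Tuple f),
      (∀ ν : HeightOneSpectrum (𝓞 D.E), D.SemiGlobalOK ν f X.M0 X.A X.ι X.Dp X.pol) → X.SignCond

/-- **[RSZ2020, Remark 5.1 (ii)]** (p. 28): «Suppose that `F₀ = ℚ`. Then there is no need for the sign condition.» (READING R7, as in (i)); the sequel («Indeed, by
the Hasse principle for hermitian forms, it is equivalent to impose … `Hom_{O_F}(T_ℓ(A₀,s̄), T_ℓ(A_s̄)) ≃ −Λ_ℓ` … Hence we recover in this case the definition of the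
integral moduli problem of [7, §2.3] …») is RECORDED in the module docstring (Tate modules).  `F₀ = ℚ` ⇔ `[F₀ : ℚ] = 1`.  Named fact (predicate on the datum).
[cite: RapoportSmithlingZhang2020Diagonal, §5.1 Remark 5.1 (ii) p. 28] -/
def Rem51_ii : Prop :=
  Module.finrank ℚ F₀ = 1 →
    ∀ {S : Scheme.{0}} (f : S ⟶ Spec (.of (𝓞 D.E))) (X : D.Tuple f),
      (∀ ν : HeightOneSpectrum (𝓞 D.E), D.SemiGlobalOK ν f X.M0 X.A X.ι X.Dp X.pol) → X.SignCond

/-! ## Theorem 5.2 (p. 28; READING R6) -/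

/-- The places of `E` removed in **Thm. 5.2 (i)**: «all places `ν` for which the induced pair `(v₀, Λ_{v₀})` is of AT type (1) or (4)» (p. 28).  REAL (over the
AT-type carriers). [cite: RapoportSmithlingZhang2020Diagonal, §5.1 Thm. 5.2 (i) p. 28] -/
def badSmooth : Set (HeightOneSpectrum (𝓞 D.E)) :=
  {ν | ∃ v : HeightOneSpectrum (𝓞 F₀), D.LiesUnder ν v ∧ (D.IsATType 1 v ∨ D.IsATType 4 v)}

/-- The places of `E` removed in **Thm. 5.2 (ii)**: «all places `ν` for which either `(v₀, Λ_{v₀})` is of AT type (4), or is of AT type (1) and for which `E_ν`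
is ramified over `ℚ_p`» (p. 28).  REAL (over the AT-type carriers). [cite: RapoportSmithlingZhang2020Diagonal, §5.1 Thm. 5.2 (ii) p. 28] -/
def badSemistable : Set (HeightOneSpectrum (𝓞 D.E)) :=
  {ν | ∃ v : HeightOneSpectrum (𝓞 F₀), D.LiesUnder ν v ∧ (D.IsATType 4 v ∨ (D.IsATType 1 v ∧ IsRamifiedOverQ ν))}

/-- **[RSZ2020, Theorem 5.2]** (p. 28): «The moduli problem just formulated is representable by a Deligne–Mumford stack `M_{K^∘_{G̃}}(G̃)` flat over `Spec O_E`.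
For every place `ν` of `E`, the base change `M_{K^∘_{G̃}}(G̃) ×_{Spec O_E} Spec O_{E,(ν)}` is canonically isomorphic to the semi-global moduli space defined in one
of Sections 4.1, 4.2, or 4.4 above. Hence: (i) `M_{K^∘_{G̃}}(G̃)` is smooth of relative dimension `n − 1` over the open subscheme of `Spec O_E` obtained by removing
all places `ν` for which the induced pair `(v₀, Λ_{v₀})` is of AT type (1) or (4) in Section 4.4. (ii) `M_{K^∘_{G̃}}(G̃)` has semi-stable reduction over the open
subscheme of `Spec O_E` obtained by removing all places `ν` for which either `(v₀, Λ_{v₀})` is of AT type (4), or is of AT type (1) and for which `E_ν` is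
ramified over `ℚ_p`.» («The only point requiring proof … is the representability … which is, however, routine», p. 28.)  Typed at level `m = 0` (`K^∘`) through
the ⟨CARRIER⟩ stack properties (READING R6) with the REAL removed sets `badSmooth`, `badSemistable` and the REAL dimension `n − 1`.  Named fact (predicate on
the datum). [cite: RapoportSmithlingZhang2020Diagonal, §5.1 Thm. 5.2 p. 28] -/
def Thm52 : Prop :=
  D.IsReprFlatDM 0 ∧ (∀ ν : HeightOneSpectrum (𝓞 D.E), D.BaseChangeSemiGlobal 0 ν) ∧
    D.IsSmoothOff 0 D.badSmooth (D.W.n - 1) ∧ D.IsSemistableOff 0 D.badSemistable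

/-! ## The conditions on `Λ♭` and `Λ` after Theorem 5.2 (pp. 28–29) and Remark 5.3 (p. 29) -/

/-- **The conditions imposed on `Λ♭` and `Λ` for `M_{K^∘_{H̃G}}(H̃G)`** (p. 28, after Thm. 5.2): «We first require that `Λ♭_v` is self-dual for all `v` which are
split or inert in `F` (i.e. we require that `V_AT^{W♭}` consists of exactly the finite places of `F₀` which ramify in `F`), and that `Λ♭_v` and `Λ_v` are
`π_v`-modular or almost `π_v`-modular for all `v` which ramify in `F` (i.e. `V_AT^{W♭}` and `V_AT^W` contain no `v` for which `(v, Λ♭_v)` or `(v, Λ_v)` is of AT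
type (4))».  Over the lattice-type carriers. [cite: RapoportSmithlingZhang2020Diagonal, §5.1 p. 28] -/
def LatticeHypCommon : Prop :=
  (∀ v : HeightOneSpectrum (𝓞 F₀), ¬ IsRamifiedPlace F₀ F v → D.IsVertexTypeAt D.Wflat.gram D.Λflat v 0) ∧
  ∀ v : HeightOneSpectrum (𝓞 F₀), IsRamifiedPlace F₀ F v →
    (D.IsPiModularAt D.Wflat.gram D.Λflat v ∨ D.IsAlmostPiModularAt D.Wflat.gram D.Λflat v) ∧
    (D.IsPiModularAt D.gramW D.Λ v ∨ D.IsAlmostPiModularAt D.gramW D.Λ v)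

/-- **The conditions for `n` odd** (p. 29): «When `n` is odd, we require that `Λ = Λ♭ ⊕ O_F u`, and that `(u, u)` is a unit at each finite place `v` unless `v` is
inert in `F` and `W_v` is non-split, in which case `ord_v(u, u) = 1` (and hence `(v, Λ_v)` is of AT type (1))».  REAL (READING R2: `Λ = Λ♭ ⊕ O_F u` is literal
in the adapted coordinates `Fin (n−1) ⊕ Unit`, `flatPlusU`; `(u,u)` = ★ `W.form u u`). [cite: RapoportSmithlingZhang2020Diagonal, §5.1 p. 29] -/
def LatticeHypOdd : Prop :=
  D.Λ = D.flatPlusU ∧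
  ∀ v : HeightOneSpectrum (𝓞 F₀),
    ((IsInert F v ∧ ¬ hermIsSplitAt F₀ F D.gramW v) → HasOrdOneAt F₀ F v (D.W.form D.u D.u)) ∧
    (¬ (IsInert F v ∧ ¬ hermIsSplitAt F₀ F D.gramW v) → IsUnitAt F₀ F v (D.W.form D.u D.u))

/-- **The conditions for `n` even** (p. 29): «let `v₁, …, v_m` be the finite places of `F₀` which ramify in `F` … for simplicity we assume that each `v_i` is of
degree one over `ℚ`. By our assumptions already made, each `(v_i, Λ♭_{v_i})` is of AT type (3). For each `i`, we further require that `(u, u)` is a unit at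
`v_i`, and that `Λ_{v_i}` is one of the two lattices for which the relation (4.30) holds with `v_i` in place of `v₀`. Then `(v_i, Λ_{v_i})` is indeed of AT type
(2). At the split and inert places `v`, we again require that `Λ_v = Λ♭_v ⊕ O_{F,v} u`, where `(u, u)` is a unit at `v` unless `v` is inert in `F` and `W_v` is
non-split, in which case `ord_v(u, u) = 1`.» — the REQUIREMENTS (REAL + ⟨CARRIER⟩ `Rel430At`, `LocallyEqAt`; `Λ♭ ⊕ O_F u` = the REAL submodule `flatPlusU` of the adapted
coordinate space); the two consequence clauses («is of AT type (3)», «is indeed of AT type (2)») are recorded, not imposed.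
[cite: RapoportSmithlingZhang2020Diagonal, §5.1 p. 29] -/
def LatticeHypEven : Prop :=
  ∀ v : HeightOneSpectrum (𝓞 F₀),
    (IsRamifiedPlace F₀ F v → IsDegreeOneOverQ v ∧ IsUnitAt F₀ F v (D.W.form D.u D.u) ∧ D.Rel430At D.Λ D.Λflat v) ∧
    (¬ IsRamifiedPlace F₀ F v →
      D.LocallyEqAt D.Λ D.flatPlusU v ∧
      ((IsInert F v ∧ ¬ hermIsSplitAt F₀ F D.gramW v) → HasOrdOneAt F₀ F v (D.W.form D.u D.u)) ∧
      (¬ (IsInert F v ∧ ¬ hermIsSplitAt F₀ F D.gramW v) → IsUnitAt F₀ F v (D.W.form D.u D.u)))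

/-- **[RSZ2020, Remark 5.3]** (p. 29), the arithmetic constraints: «Let `d := [F₀ : ℚ]`. First consider the case when `n = 2m + 1` is odd. Then our assumptions on
`Λ♭` imply that `W♭` is split at all finite places of `F₀`. On the other hand, at each archimedean place `φ`, the Hasse invariant `inv_φ(W♭_φ)` is equal to
`(−1)^{m−1}` if `φ = φ₀`, and to `(−1)^m` if `φ ≠ φ₀`. Hence the product formula (1.5) imposes the congruence **(5.4)** `dm ≡ 1 mod 2`. In particular, since this
requires `d` to be odd, the extension `F/F₀` is forced to be ramified at at least one finite place … Now consider the case when `n = 2m` is even. … we claim that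
`F/F₀` being everywhere unramified is again disallowed. … we again obtain the congruence `dm ≡ 1 mod 2`, forcing `d` to be odd.» — typed as: under
`LatticeHypCommon`, for `n = 2m + 1` odd (a) `W♭_v` is split at every finite `v` and (b) **(5.4)** `d·m ≡ 1 (mod 2)`; and, for either parity, (c) some finite place of
`F₀` ramifies in `F` («forced to be ramified at at least one finite place» ∕ «everywhere unramified is again disallowed»; in the even case the congruence is
derived only inside the excluded everywhere-unramified scenario and is not asserted).  The archimedean Hasse invariants (the printed reason) and the existence
converses are RECORDED.  REAL conclusions over the carrier hypotheses.  Named fact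
(predicate on the datum). [cite: RapoportSmithlingZhang2020Diagonal, §5.1 Remark 5.3 (5.4) p. 29] -/
def Rem53 : Prop :=
  D.LatticeHypCommon →
    (Odd D.W.n →
      (∀ v : HeightOneSpectrum (𝓞 F₀), hermIsSplitAt F₀ F D.Wflat.gram v) ∧ Module.finrank ℚ F₀ * ((D.W.n - 1) / 2) % 2 = 1) ∧
    ∃ v : HeightOneSpectrum (𝓞 F₀), IsRamifiedPlace F₀ F v

/-! ## §5.2 «Drinfeld level structure» (p. 30): (5.7), (5.8), `N(m)`, `K_G^m`, Theorem 5.4 -/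

/-- **(5.7)**, second set: «`spl_Φ := {v ∈ spl ∣ every place ν of E above v matches Φ}`» (p. 30; «cf. (4.19)» = ⟨CARRIER⟩ `Matches`).
[cite: RapoportSmithlingZhang2020Diagonal, §5.2 (5.7) p. 30] -/
def splPhi : Set (HeightOneSpectrum (𝓞 F₀)) :=
  {v | IsSplit F v ∧ ∀ ν : HeightOneSpectrum (𝓞 D.E), D.LiesUnder ν v → D.Matches ν}

/-- **(5.8)** «we fix a function `m : spl → ℤ_{≥0}` with finite support contained in `spl_Φ`» (p. 30) — as a function on all finite places of `F₀` vanishing off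
`spl_Φ` (READING: extension by zero), with finite support.  REAL. [cite: RapoportSmithlingZhang2020Diagonal, §5.2 (5.8) p. 30] -/
def IsLevelFn (m : HeightOneSpectrum (𝓞 F₀) → ℕ) : Prop :=
  (Function.support m).Finite ∧ Function.support m ⊆ D.splPhi

/-- **`K_G^m := {g ∈ G(𝔸_{F₀,f}) ∣ g(Λ ⊗_{O_F} Ô_F) = Λ ⊗_{O_F} Ô_F and g ≡ id mod N(m)}`** (p. 30), ⟨CARRIER⟩ `stabGfinMod` at the REAL `N(m)`; «As usual, we define
`K^m_{G̃} := K_{Z^ℚ} × K^m_G` as in (3.6)». [cite: RapoportSmithlingZhang2020Diagonal, §5.2 p. 30] -/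
abbrev KGm (m : HeightOneSpectrum (𝓞 F₀) → ℕ) : Subgroup D.W.Gfin := D.stabGfinMod D.W D.Λ (levelIdeal F₀ F m)

/-- «Note that if `m = 0`, then `K^m_G = K^∘_G` and `K^m_{G̃} = K^∘_{G̃}`» (p. 30): consistency of the two ⟨CARRIER⟩ level subgroups at `N(0) = O_{F₀}`.  Named
fact (predicate on the datum; the printed remark). [cite: RapoportSmithlingZhang2020Diagonal, §5.2 p. 30] -/
def Eq58_level_zero : Prop :=
  D.KGm 0 = D.KG

/-- **[RSZ2020, Theorem 5.4]** (p. 30): «`M_{K^m_{G̃}}(G̃)` is a regular Deligne–Mumford stack finite and flat over `M_{K^∘_{G̃}}(G̃)`. For `N(m)` big enough,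
`M_{K^m_{G̃}}(G̃)` is relatively representable over `M₀^ξ`. For every finite place `ν` of `E`, the base change `M_{K^m_{G̃}}(G̃) ×_{Spec O_E} Spec O_{E,(ν)}` is
canonically isomorphic to (variants of) the semi-global moduli space defined in one of Sections 4.1, 4.3, or 4.4 above.» (where «`M_{K^m_{G̃}}(G̃)` [is] the
normalization of `M_{K^∘_{G̃}}(G̃)` in `M_{K^m_{G̃}}(G̃)`», p. 30; «As with Theorem 5.2, the proof … is routine»).  Typed for every level function `m` of (5.8) through
the ⟨CARRIER⟩ stack properties (READING R6); «for `N(m)` big enough» = there is a non-zero ideal `N₀ ⊂ O_{F₀}` such that the clause holds whenever `N(m) ⊂ N₀`.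
Named fact (predicate on the datum). [cite: RapoportSmithlingZhang2020Diagonal, §5.2 Thm. 5.4 p. 30] -/
def Thm54 : Prop :=
  (∀ m, D.IsLevelFn m → D.IsRegularFiniteFlatOverLevelZero m ∧ ∀ ν : HeightOneSpectrum (𝓞 D.E), D.BaseChangeSemiGlobal m ν) ∧
  ∃ N₀ : Ideal (𝓞 F₀), N₀ ≠ ⊥ ∧ ∀ m, D.IsLevelFn m → levelIdeal F₀ F m ≤ N₀ → D.IsRelReprOverM0 m

end Sec5Data


/-! ## ED. 2 (squad rulings R-6 ∕ R-9a): the dedup bridge PROVED -/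

/-- **The dedup bridge R-6 holds** (discharge of `RSZ2020_2_IsSimil_iff_mem_GU`, squad ruling R-9a: a tree-provable closed row is a theorem): RSZ's
similitude identity (★ `Sec2GroupTheoreticSetup.IsSimil`, [RSZ2020] §2.1 p. 7) IS membership in KR2013's ★ `GU σ J` ([KR2013] §4.1) for `σ = c ⊗ 1`,
`J ⊗ 1`; the `σ`-fixed clause holds because `ofR c = 1 ⊗ (1 ⊗ c)` is fixed by `c̄ ⊗ 1` (★ `UnitaryScheme.baseConj_tmul`).  Our proof (by unfolding).
[cite: RapoportSmithlingZhang2020Diagonal, §2.1 p. 7] [cite: KudlaRapoport2013, §4.1 (arXiv v2 p. 19)] -/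
theorem RSZ2020_2_IsSimil_iff_mem_GU_holds : RSZ2020_2_IsSimil_iff_mem_GU F₀ F := by
  intro R _ _ κ _ _ J g c
  have hfix : (cR F₀ F R : ER F₀ F R →ₐ[F₀] ER F₀ F R) (ofR F₀ F R (c : R)) = ofR F₀ F R (c : R) := by
    simp [ofR, Literature.NumberTheory.Automorphic.UnitaryScheme.baseConj]
  constructor
  · intro h
    refine ⟨?_, ?_⟩
    · simpa using hfix
    · simpa [IsSimil] using h
  · rintro ⟨-, h⟩
    simpa [IsSimil] using h

end Literature.AlgebraicGeometry.ShimuraVarieties.RapoportSmithlingZhang2020.Sec5GlobalIntegralModels
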